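import Summits.AtomisticToContinuum.HydrodynamicLimit.Theorems.ImplosionDichotomyPolynomialCompressionUniquenessPrimitive

/-!
# The relative-energy balance for two hard-sphere Euler solutions (pointwise identity)

Helper file for the line `log-lipschitz-budget` of the crux
`ImplosionDichotomy.PolynomialCompression` (stub `stub_conditionalExistence`, component (c):
uniqueness of classical solutions). For two classical solutions `(ρ, u, θ)`, `(ρ', u', θ')` of
the hard-sphere Euler system on `[0, T) × 𝕋³` with pressure `p = ρ θ ζ(ρ)` (`ζ` smooth on an open
set containing the values of both densities) put `α = ρ - ρ'`, `w = u - u'`, `β = θ - θ'` and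
symmetrise the linearised system with the weights `A = θ γ(ρ)/ρ` (`γ = ζ + id·ζ' = ∂_ρ p / θ`) and
`B = 3ρ/(2θ)`:

* energy density `e = ½ (A α² + ρ |w|² + B β²)`,
* fluxes `Φᵢ = ½ (A uᵢ α² + ρ uᵢ |w|² + B uᵢ β²) + θγ(ρ) α wᵢ + ρζ(ρ) β wᵢ`.

`hsEuler_relativeEnergy_balance` is the pointwise identity `∂ₜe + Σᵢ ∂ᵢΦᵢ = R` on `[0, T) × 𝕋³`
with an EXPLICIT remainder `R` that is a bilinear form in the small quantities
`α, β, wⱼ, ζ(ρ) - ζ(ρ'), γ(ρ) - γ(ρ')` whose coefficients are polynomials in the two solutions,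
their first derivatives and the derivatives of the weights — no derivative of `α, β, w` survives:
the principal part is a total divergence because the weights symmetrise the system
(`A ρ = θ γ(ρ)`, `2 B θ = 3 ρ`). Calculus: product rules along coordinate lines and time slices
(`UniquenessPrimitive`); algebra: the primitive equations of both solutions
(`hsEuler_density_eq`, `hsEuler_velocity_eq`, `hsEuler_temperature_eq`) fed to
`linear_combination` (the polynomial identity was machine-checked before being typed).
-/

noncomputable section

namespace Summit.AtomisticToContinuum.HydrodynamicLimit.Theorems

open Set Filter Topology MeasureTheory
open scoped ContDiff
open Literature.MathematicalPhysics.KineticTheory Literature.Analysis.FunctionSpaces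

section Identity

variable {σ T : ℝ} {ρ θ ρ' θ' : ℝ → T3 → ℝ} {u u' : ℝ → T3 → V3} {ζ : ℝ → ℝ} {J : Set ℝ}

/-- Along a classical solution with density valued in the open set `J` on which `ζ` is smooth,
the composite field `ζ(ρ)` is jointly smooth on `[0, T) × 𝕋³`. [folklore] -/
theorem isSmoothSpaceTimeOn_comp_density (hρ : Torus.IsSmoothSpaceTimeOn (Ico 0 T) ρ)
    (hζ : ContDiffOn ℝ ∞ ζ J) (hρJ : ∀ t ∈ Ico 0 T, ∀ x, ρ t x ∈ J) :
    Torus.IsSmoothSpaceTimeOn (Ico 0 T) (fun s y => ζ (ρ s y)) := by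
  refine hζ.comp hρ ?_
  rintro ⟨s, v⟩ hp
  exact hρJ s (mem_prod.1 hp).1 _

/-- The symmetrising weight `A = θ (ζ(ρ) + ρ ζ'(ρ)) / ρ` of a classical solution is jointly smooth
on `[0, T) × 𝕋³` (`ρ > 0`). [folklore] -/
theorem isSmoothSpaceTimeOn_weightA (hE : IsHardSphereEulerSolution σ T ρ u θ) (hJ : IsOpen J)
    (hζ : ContDiffOn ℝ ∞ ζ J) (hρJ : ∀ t ∈ Ico 0 T, ∀ x, ρ t x ∈ J) :
    Torus.IsSmoothSpaceTimeOn (Ico 0 T)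
      (fun s y => θ s y * (ζ (ρ s y) + ρ s y * deriv ζ (ρ s y)) / ρ s y) := by
  have h1 := isSmoothSpaceTimeOn_comp_density hE.smooth_density hζ hρJ
  have h2 := isSmoothSpaceTimeOn_comp_density hE.smooth_density (hζ.deriv_of_isOpen hJ le_rfl) hρJ
  refine ContDiffOn.div (hE.smooth_temperature.mul (h1.add (hE.smooth_density.mul h2)))
    hE.smooth_density ?_
  rintro ⟨s, v⟩ hp
  exact (hE.density_pos s (mem_prod.1 hp).1 _).ne'

/-- The symmetrising weight `B = (3/2) ρ / θ` of a classical solution is jointly smooth on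
`[0, T) × 𝕋³` (`θ > 0`). [folklore] -/
theorem isSmoothSpaceTimeOn_weightB (hE : IsHardSphereEulerSolution σ T ρ u θ) :
    Torus.IsSmoothSpaceTimeOn (Ico 0 T) (fun s y => 3 / 2 * ρ s y / θ s y) := by
  refine ContDiffOn.div (contDiffOn_const.mul hE.smooth_density) hE.smooth_temperature ?_
  rintro ⟨s, v⟩ hp
  exact (hE.temperature_pos s (mem_prod.1 hp).1 _).ne'

/-- **The relative-energy balance, pointwise.** For two classical hard-sphere–Euler solutions on
`[0, T) × 𝕋³` with pressure law `p = ρ θ ζ(ρ)` (`ζ` smooth on an open set `J` containing the values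
of both densities), the energy density `e = ½(A α² + ρ|w|² + B β²)` of the difference
`(α, w, β) = (ρ - ρ', u - u', θ - θ')` (weights `A = θ(ζ(ρ) + ρζ'(ρ))/ρ`, `B = 3ρ/(2θ)`) and the
fluxes `Φᵢ = ½(A uᵢ α² + ρ uᵢ |w|² + B uᵢ β²) + θ(ζ(ρ) + ρζ'(ρ)) α wᵢ + ρ ζ(ρ) β wᵢ` satisfy
`∂ₜe + Σᵢ ∂ᵢΦᵢ = R` with the explicit zero-order remainder `R` displayed on the right
(a bilinear form in `α, β, wⱼ, ζ(ρ) - ζ(ρ'), γ(ρ) - γ(ρ')`, `γ = ζ + id·ζ'`). [folklore] -/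
theorem hsEuler_relativeEnergy_balance :
    ∀ {σ T : ℝ} {ρ θ ρ' θ' : ℝ → T3 → ℝ} {u u' : ℝ → T3 → V3} {ζ : ℝ → ℝ} {J : Set ℝ},
    IsHardSphereEulerSolution σ T ρ u θ → IsHardSphereEulerSolution σ T ρ' u' θ' → IsOpen J →
    ContDiffOn ℝ (⊤ : ℕ∞) ζ J → (∀ t ∈ Ico 0 T, ∀ x, ρ t x ∈ J) → (∀ t ∈ Ico 0 T, ∀ x, ρ' t x ∈ J) →
    (∀ t ∈ Ico 0 T, ∀ x, hsPressure σ (ρ t x) (θ t x) = ρ t x * θ t x * ζ (ρ t x)) →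
    (∀ t ∈ Ico 0 T, ∀ x, hsPressure σ (ρ' t x) (θ' t x) = ρ' t x * θ' t x * ζ (ρ' t x)) →
    ∀ {t : ℝ}, t ∈ Ico 0 T → ∀ x : T3,
    Torus.timeDerivWithin (Ico 0 T) (fun s y => 1 / 2 *
        (θ s y * (ζ (ρ s y) + ρ s y * deriv ζ (ρ s y)) / ρ s y * (ρ s y - ρ' s y) ^ 2 +
          ρ s y * ‖u s y - u' s y‖ ^ 2 + 3 / 2 * ρ s y / θ s y * (θ s y - θ' s y) ^ 2)) t x +
      ∑ i, Torus.partialDeriv i (fun y =>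
        1 / 2 * (θ t y * (ζ (ρ t y) + ρ t y * deriv ζ (ρ t y)) / ρ t y * u t y i *
              (ρ t y - ρ' t y) ^ 2 +
            ρ t y * u t y i * ‖u t y - u' t y‖ ^ 2 +
            3 / 2 * ρ t y / θ t y * u t y i * (θ t y - θ' t y) ^ 2) +
          θ t y * (ζ (ρ t y) + ρ t y * deriv ζ (ρ t y)) * (ρ t y - ρ' t y) * (u t y i - u' t y i) +
          ρ t y * ζ (ρ t y) * (θ t y - θ' t y) * (u t y i - u' t y i)) x =
      (1 / 2 * Torus.timeDerivWithin (Ico 0 T)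
            (fun s y => θ s y * (ζ (ρ s y) + ρ s y * deriv ζ (ρ s y)) / ρ s y) t x -
          θ t x * (ζ (ρ t x) + ρ t x * deriv ζ (ρ t x)) / ρ t x *
            ∑ i, Torus.partialDeriv i (fun y => u' t y i) x +
          1 / 2 * ∑ i, Torus.partialDeriv i
            (fun y => θ t y * (ζ (ρ t y) + ρ t y * deriv ζ (ρ t y)) / ρ t y * u t y i) x) *
        (ρ t x - ρ' t x) ^ 2 +
      (1 / 2 * Torus.timeDerivWithin (Ico 0 T) (fun s y => 3 / 2 * ρ s y / θ s y) t x -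
          2 / 3 * (3 / 2 * ρ t x / θ t x) * ζ (ρ t x) *
            ∑ i, Torus.partialDeriv i (fun y => u' t y i) x +
          1 / 2 * ∑ i, Torus.partialDeriv i (fun y => 3 / 2 * ρ t y / θ t y * u t y i) x) *
        (θ t x - θ' t x) ^ 2 +
      ∑ j, (-(θ t x * (ζ (ρ t x) + ρ t x * deriv ζ (ρ t x)) / ρ t x *
              Torus.partialDeriv j (ρ' t) x) -
            ∑ i, u' t x i * Torus.partialDeriv i (fun y => u' t y j) x -
            ζ (ρ t x) * Torus.partialDeriv j (θ' t) x -
            Torus.timeDerivWithin (Ico 0 T) (fun s y => u' s y j) t x +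
            Torus.partialDeriv j (fun y => θ t y * (ζ (ρ t y) + ρ t y * deriv ζ (ρ t y))) x) *
          (ρ t x - ρ' t x) * (u t x j - u' t x j) +
      ∑ i, ∑ j, -(ρ t x * Torus.partialDeriv i (fun y => u' t y j) x) *
          (u t x i - u' t x i) * (u t x j - u' t x j) +
      ∑ j, (-((ζ (ρ t x) + ρ t x * deriv ζ (ρ t x)) * Torus.partialDeriv j (ρ' t) x) -
            3 / 2 * ρ t x / θ t x * Torus.partialDeriv j (θ' t) x +
            Torus.partialDeriv j (fun y => ρ t y * ζ (ρ t y)) x) *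
          (θ t x - θ' t x) * (u t x j - u' t x j) +
      ∑ j, -(θ' t x * Torus.partialDeriv j (ρ' t) x) *
          ((ζ (ρ t x) + ρ t x * deriv ζ (ρ t x)) - (ζ (ρ' t x) + ρ' t x * deriv ζ (ρ' t x))) *
          (u t x j - u' t x j) +
      ∑ j, -(ρ' t x * Torus.partialDeriv j (θ' t) x) * (ζ (ρ t x) - ζ (ρ' t x)) *
          (u t x j - u' t x j) +
      -(2 / 3 * (3 / 2 * ρ t x / θ t x) * θ' t x * ∑ i, Torus.partialDeriv i (fun y => u' t y i) x) *
        (θ t x - θ' t x) * (ζ (ρ t x) - ζ (ρ' t x)) := by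
  intro σ T ρ θ ρ' θ' u u' ζ J hE hE' hJ hζ hρJ hρJ' hp hp' t ht x
  have hU : UniqueDiffOn ℝ (Ico (0 : ℝ) T) := uniqueDiffOn_Ico 0 T
  -- smooth slices
  have hρ1 : Torus.IsContDiff 1 (ρ t) := (hE.smooth_density.isSmooth_slice ht).isContDiff (by simp)
  have hθ1 : Torus.IsContDiff 1 (θ t) :=
    (hE.smooth_temperature.isSmooth_slice ht).isContDiff (by simp)
  have hu1 : Torus.IsContDiff 1 (u t) := (hE.smooth_velocity.isSmooth_slice ht).isContDiff (by simp)
  have huj1 : ∀ i, Torus.IsContDiff 1 (fun y => u t y i) := fun i => isContDiff_apply_coord hu1 i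
  have hρ1' : Torus.IsContDiff 1 (ρ' t) :=
    (hE'.smooth_density.isSmooth_slice ht).isContDiff (by simp)
  have hθ1' : Torus.IsContDiff 1 (θ' t) :=
    (hE'.smooth_temperature.isSmooth_slice ht).isContDiff (by simp)
  have hu1' : Torus.IsContDiff 1 (u' t) :=
    (hE'.smooth_velocity.isSmooth_slice ht).isContDiff (by simp)
  have huj1' : ∀ i, Torus.IsContDiff 1 (fun y => u' t y i) := fun i => isContDiff_apply_coord hu1' i
  have hζ1 : Torus.IsContDiff 1 (fun y => ζ (ρ t y)) :=
    (hζ.of_le (by simp)).comp_contDiff hρ1 fun v => hρJ t ht _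
  have hζd1 : Torus.IsContDiff 1 (fun y => deriv ζ (ρ t y)) :=
    ((hζ.deriv_of_isOpen (m := ∞) hJ le_rfl).of_le (by simp)).comp_contDiff hρ1 fun v => hρJ t ht _
  -- the weights and the pressure coefficients as jointly smooth fields, and their slices
  have hAf := isSmoothSpaceTimeOn_weightA hE hJ hζ hρJ
  have hBf := isSmoothSpaceTimeOn_weightB hE
  have hA1 : Torus.IsContDiff 1
      (fun y => θ t y * (ζ (ρ t y) + ρ t y * deriv ζ (ρ t y)) / ρ t y) :=
    (hAf.isSmooth_slice ht).isContDiff (by simp)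
  have hB1 : Torus.IsContDiff 1 (fun y => 3 / 2 * ρ t y / θ t y) :=
    (hBf.isSmooth_slice ht).isContDiff (by simp)
  have hpr1 : Torus.IsContDiff 1 (fun y => θ t y * (ζ (ρ t y) + ρ t y * deriv ζ (ρ t y))) :=
    (ContDiff.mul hθ1 (ContDiff.add hζ1 (ContDiff.mul hρ1 hζd1)) :)
  have hph1 : Torus.IsContDiff 1 (fun y => ρ t y * ζ (ρ t y)) := (hρ1.mul hζ1 :)
  have hAu1 : ∀ i, Torus.IsContDiff 1
      (fun y => θ t y * (ζ (ρ t y) + ρ t y * deriv ζ (ρ t y)) / ρ t y * u t y i) :=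
    fun i => (hA1.mul (huj1 i) :)
  have hBu1 : ∀ i, Torus.IsContDiff 1 (fun y => 3 / 2 * ρ t y / θ t y * u t y i) :=
    fun i => (hB1.mul (huj1 i) :)
  -- coordinate-line derivatives at `x`
  have cρ := fun i => hasDerivAt_coordLine hρ1 x i
  have cθ := fun i => hasDerivAt_coordLine hθ1 x i
  have cu := fun i k => hasDerivAt_coordLine (huj1 k) x i
  have cρ' := fun i => hasDerivAt_coordLine hρ1' x i
  have cθ' := fun i => hasDerivAt_coordLine hθ1' x i
  have cu' := fun i k => hasDerivAt_coordLine (huj1' k) x i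
  have cAu := fun i => hasDerivAt_coordLine (hAu1 i) x i
  have cBu := fun i => hasDerivAt_coordLine (hBu1 i) x i
  have cpr := fun i => hasDerivAt_coordLine hpr1 x i
  have cph := fun i => hasDerivAt_coordLine hph1 x i
  -- time-slice derivatives at `x`
  have sρ := hE.smooth_density.hasDerivWithinAt_slice ht x
  have sθ := hE.smooth_temperature.hasDerivWithinAt_slice ht x
  have su := fun k => (hE.smooth_velocity.apply k).hasDerivWithinAt_slice ht x
  have sρ' := hE'.smooth_density.hasDerivWithinAt_slice ht x
  have sθ' := hE'.smooth_temperature.hasDerivWithinAt_slice ht x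
  have su' := fun k => (hE'.smooth_velocity.apply k).hasDerivWithinAt_slice ht x
  have sA := hAf.hasDerivWithinAt_slice ht x
  have sB := hBf.hasDerivWithinAt_slice ht x
  -- `|u - u'|²` in coordinates
  have hnorm : ∀ s y, ‖u s y - u' s y‖ ^ 2 =
      (u s y 0 - u' s y 0) ^ 2 + (u s y 1 - u' s y 1) ^ 2 + (u s y 2 - u' s y 2) ^ 2 := by
    intro s y
    simp only [EuclideanSpace.norm_sq_eq, Fin.sum_univ_three, PiLp.sub_apply, Real.norm_eq_abs,
      sq_abs]
  simp only [hnorm]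
  -- (1) the time derivative of the energy density
  rw [timeDerivWithin_eq_of_hasDerivWithinAt ((((sA.fun_mul ((sρ.fun_sub sρ').fun_pow 2)).fun_add
    (sρ.fun_mul ((((su 0).fun_sub (su' 0)).fun_pow 2).fun_add (((su 1).fun_sub (su' 1)).fun_pow 2) |>.fun_add
      (((su 2).fun_sub (su' 2)).fun_pow 2)))).fun_add (sB.fun_mul ((sθ.fun_sub sθ').fun_pow 2))).const_mul
        (1 / 2)) (hU t ht)]
  -- (2) the divergence of the flux, coordinate by coordinate
  have hΦ : ∀ i, Torus.partialDeriv i (fun y =>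
      1 / 2 * (θ t y * (ζ (ρ t y) + ρ t y * deriv ζ (ρ t y)) / ρ t y * u t y i *
            (ρ t y - ρ' t y) ^ 2 +
          ρ t y * u t y i * ((u t y 0 - u' t y 0) ^ 2 + (u t y 1 - u' t y 1) ^ 2 +
            (u t y 2 - u' t y 2) ^ 2) +
          3 / 2 * ρ t y / θ t y * u t y i * (θ t y - θ' t y) ^ 2) +
        θ t y * (ζ (ρ t y) + ρ t y * deriv ζ (ρ t y)) * (ρ t y - ρ' t y) * (u t y i - u' t y i) +
        ρ t y * ζ (ρ t y) * (θ t y - θ' t y) * (u t y i - u' t y i)) x =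
      1 / 2 * (Torus.partialDeriv i
              (fun y => θ t y * (ζ (ρ t y) + ρ t y * deriv ζ (ρ t y)) / ρ t y * u t y i) x *
            (ρ t x - ρ' t x) ^ 2 +
          θ t x * (ζ (ρ t x) + ρ t x * deriv ζ (ρ t x)) / ρ t x * u t x i *
            (2 * (ρ t x - ρ' t x) * (Torus.partialDeriv i (ρ t) x - Torus.partialDeriv i (ρ' t) x)) +
          ((ρ t x * Torus.partialDeriv i (fun y => u t y i) x +
              Torus.partialDeriv i (ρ t) x * u t x i) *
            ((u t x 0 - u' t x 0) ^ 2 + (u t x 1 - u' t x 1) ^ 2 + (u t x 2 - u' t x 2) ^ 2) +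
          ρ t x * u t x i * (2 * (u t x 0 - u' t x 0) * (Torus.partialDeriv i (fun y => u t y 0) x -
              Torus.partialDeriv i (fun y => u' t y 0) x) +
            2 * (u t x 1 - u' t x 1) * (Torus.partialDeriv i (fun y => u t y 1) x -
              Torus.partialDeriv i (fun y => u' t y 1) x) +
            2 * (u t x 2 - u' t x 2) * (Torus.partialDeriv i (fun y => u t y 2) x -
              Torus.partialDeriv i (fun y => u' t y 2) x))) +
          (Torus.partialDeriv i (fun y => 3 / 2 * ρ t y / θ t y * u t y i) x * (θ t x - θ' t x) ^ 2 +
            3 / 2 * ρ t x / θ t x * u t x i *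
              (2 * (θ t x - θ' t x) * (Torus.partialDeriv i (θ t) x - Torus.partialDeriv i (θ' t) x)))) +
        (Torus.partialDeriv i (fun y => θ t y * (ζ (ρ t y) + ρ t y * deriv ζ (ρ t y))) x *
            (ρ t x - ρ' t x) * (u t x i - u' t x i) +
          θ t x * (ζ (ρ t x) + ρ t x * deriv ζ (ρ t x)) *
            ((Torus.partialDeriv i (ρ t) x - Torus.partialDeriv i (ρ' t) x) * (u t x i - u' t x i) +
              (ρ t x - ρ' t x) * (Torus.partialDeriv i (fun y => u t y i) x -
                Torus.partialDeriv i (fun y => u' t y i) x))) +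
        (Torus.partialDeriv i (fun y => ρ t y * ζ (ρ t y)) x * (θ t x - θ' t x) * (u t x i - u' t x i) +
          ρ t x * ζ (ρ t x) *
            ((Torus.partialDeriv i (θ t) x - Torus.partialDeriv i (θ' t) x) * (u t x i - u' t x i) +
              (θ t x - θ' t x) * (Torus.partialDeriv i (fun y => u t y i) x -
                Torus.partialDeriv i (fun y => u' t y i) x))) := by
    intro i
    exact partialDeriv_eq_of_hasDerivAt ((((((cAu i).fun_mul (((cρ i).fun_sub (cρ' i)).fun_pow 2)).fun_add
      (((cρ i).fun_mul (cu i i)).fun_mul (((((cu i 0).fun_sub (cu' i 0)).fun_pow 2).fun_add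
        (((cu i 1).fun_sub (cu' i 1)).fun_pow 2)).fun_add (((cu i 2).fun_sub (cu' i 2)).fun_pow 2)))).fun_add
      ((cBu i).fun_mul (((cθ i).fun_sub (cθ' i)).fun_pow 2))).const_mul (1 / 2) |>.fun_add
      (((cpr i).fun_mul ((cρ i).fun_sub (cρ' i))).fun_mul ((cu i i).fun_sub (cu' i i))) |>.fun_add
      (((cph i).fun_mul ((cθ i).fun_sub (cθ' i))).fun_mul ((cu i i).fun_sub (cu' i i)))).congr_deriv
      (by simp only [zero_smul, Torus.proj_zero, add_zero]; ring))
  simp only [hΦ]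
  -- (3) the primitive equations of both solutions and the symmetriser relations
  have hP1 := hsEuler_density_eq hE ht x
  have hP1' := hsEuler_density_eq hE' ht x
  have hP2 := fun k => hsEuler_velocity_eq hE hJ hζ hρJ hp ht x k
  have hP2' := fun k => hsEuler_velocity_eq hE' hJ hζ hρJ' hp' ht x k
  have hP20 := hP2 0
  have hP21 := hP2 1
  have hP22 := hP2 2
  have hP20' := hP2' 0
  have hP21' := hP2' 1
  have hP22' := hP2' 2
  have hP3 := hsEuler_temperature_eq hE hJ hζ hρJ hp ht x
  have hP3' := hsEuler_temperature_eq hE' hJ hζ hρJ' hp' ht x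
  have hρ0 : ρ t x ≠ 0 := (hE.density_pos t ht x).ne'
  have hθ0 : θ t x ≠ 0 := (hE.temperature_pos t ht x).ne'
  have hA : θ t x * (ζ (ρ t x) + ρ t x * deriv ζ (ρ t x)) / ρ t x * ρ t x =
      θ t x * (ζ (ρ t x) + ρ t x * deriv ζ (ρ t x)) := div_mul_cancel₀ _ hρ0
  have hB : 2 * (3 / 2 * ρ t x / θ t x) * θ t x = 3 * ρ t x := by
    field_simp
  simp only [Fin.sum_univ_three] at hP1 hP1' hP20 hP21 hP22 hP20' hP21' hP22' hP3 hP3'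
  repeat rw [Fin.sum_univ_three]
  linear_combination
    (θ t x * (ζ (ρ t x) + ρ t x * deriv ζ (ρ t x)) / ρ t x * (ρ t x - ρ' t x) +
        1 / 2 * ((u t x 0 - u' t x 0) ^ 2 + (u t x 1 - u' t x 1) ^ 2 + (u t x 2 - u' t x 2) ^ 2)) *
      hP1 -
    θ t x * (ζ (ρ t x) + ρ t x * deriv ζ (ρ t x)) / ρ t x * (ρ t x - ρ' t x) * hP1' +
    (u t x 0 - u' t x 0) * hP20 + (u t x 1 - u' t x 1) * hP21 + (u t x 2 - u' t x 2) * hP22 -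
    (u t x 0 - u' t x 0) * hP20' - (u t x 1 - u' t x 1) * hP21' - (u t x 2 - u' t x 2) * hP22' +
    3 / 2 * ρ t x / θ t x * (θ t x - θ' t x) * hP3 -
    3 / 2 * ρ t x / θ t x * (θ t x - θ' t x) * hP3' -
    (ρ t x - ρ' t x) * ((Torus.partialDeriv 0 (fun y => u t y 0) x -
        Torus.partialDeriv 0 (fun y => u' t y 0) x) +
      (Torus.partialDeriv 1 (fun y => u t y 1) x - Torus.partialDeriv 1 (fun y => u' t y 1) x) +
      (Torus.partialDeriv 2 (fun y => u t y 2) x - Torus.partialDeriv 2 (fun y => u' t y 2) x)) * hA -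
    1 / 3 * ζ (ρ t x) * (θ t x - θ' t x) * ((Torus.partialDeriv 0 (fun y => u t y 0) x -
        Torus.partialDeriv 0 (fun y => u' t y 0) x) +
      (Torus.partialDeriv 1 (fun y => u t y 1) x - Torus.partialDeriv 1 (fun y => u' t y 1) x) +
      (Torus.partialDeriv 2 (fun y => u t y 2) x - Torus.partialDeriv 2 (fun y => u' t y 2) x)) * hB

end Identity

end Summit.AtomisticToContinuum.HydrodynamicLimit.Theorems

end
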